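import Mathlib
import Summits.Ventures.HSemireg.LineLawClassLawSufficiency
import Summits.Ventures.HSemireg.LineLawAuxiliaryClass

/-!
# LINE LAW — THEOREM E «⇐» ASSEMBLED WITHOUT ANY CLASS INPUT BY VALUE (ENGINE-W code B, #B25)

LINE-LAW-THEOREMS-B §6″ THEOREM E («⇐»): a compatible ALIGNED family — a common root `A` modulo `L` at which all weight ideals
`𝔞_c(A) = (c, −A + √m)`, `c ∈ S`, are proper and lie in ONE ideal class — is reached at some `T = r·L`.  Kernel so far: #B20
`LineLawClassLawSufficiency.classLaw_sufficiency` GIVEN the auxiliary Cox-(7.8) relation `(x₀)·(𝔞_r(A)·𝔞_L(A)) = (y₀)·𝔞_{c₀}(A)`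
(«an ideal in the class `κ − [𝔞_L(A)]`, by value — Cox Cor. 7.17»).  #B24 `LineLawAuxiliaryClass.exists_aux_relation` now SUPPLIES
that relation at some root `B` with `r` prime to `L`; this file re-roots (`A' ≡ A (mod L)`, `A' ≡ B (mod r)`: 315 `root_glue`, 331
`span_pair_congr`), transports the bookkeeping to `A'` (`gcd_congr`, `bezout_congr`) and applies #B20:
* `classLaw_reached` — `m < 0`; weights `c i` with coweights `d i`, `c i · d i = L > 0`; `L ∣ A² − m`; the bookkeeping gcd
  `gcd(d i, c i, 2A) = 1` (necessary on every reached line, #B21); the `c i₀`-form and the `L`-form at `A` primitive; alignment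
  `(x i)·𝔞_{c i}(A) = (y i)·𝔞_{c i₀}(A)`, `y i ≠ 0`.  THEN there are `r > 0` and `A' ≡ A (mod L)` such that every weight `c i` has a
  primitive `z_i ∈ ℤ√m` with `N z_i = r·d i = (rL)∕c i` dividing `A' − √m` — i.e. (THEOREM CF⁶ by value) the line is reached at
  `T = rL`.  No class-existence input remains; the only «by value» left in THEOREM E is the reading of «reached» (CF⁶).
Honest framing: ideal arithmetic of `ℤ√m` only; Mukai vectors and lattices elsewhere, not objects; nothing here says that HC,
HC_CM or HC_AV holds.
-/

open scoped nonZeroDivisors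

namespace Summit.Ventures.HSemireg.LineLawClassLawAssembled

open Zsqrtd
open Literature.NumberTheory.QuadraticFields.Quadratic
open Summit.Ventures.HSemireg.LineLawPrincipalGenus (root_glue)
open Summit.Ventures.HSemireg.LineLawRamifiedCapture (span_pair_congr)
open Summit.Ventures.HSemireg.LineLawAuxiliaryClass (exists_aux_relation ideal_rootForm)
open Summit.Ventures.HSemireg.LineLawClassLawSufficiency (classLaw_sufficiency)

/-- A root form `(n, 2A, k)` (`A² − n k = m`, `n > 0`) with a Bézout certificate of primitivity is primitive positive definite of
discriminant `4m`. -/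
theorem rootForm_isPosPrim {m n k A : ℤ} (hn : 0 < n) (hk : A ^ 2 - n * k = m)
    (hp : ∃ x y z : ℤ, x * n + y * (2 * A) + z * k = 1) : (⟨n, 2 * A, k⟩ : BinQF).IsPosPrim (4 * m) := by
  refine ⟨by simp only [BinQF.disc]; linear_combination 4 * hk, hn, (BinQF.isPrimitive_iff _).2 ?_⟩
  intro d hd1 hd2 hd3
  obtain ⟨x, y, z, h⟩ := hp
  refine isUnit_of_dvd_one ?_
  rw [← h]
  exact dvd_add (dvd_add (dvd_mul_of_dvd_right hd1 _) (dvd_mul_of_dvd_right hd2 _)) (dvd_mul_of_dvd_right hd3 _)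

/-- **The Bézout certificate moves along the root**: `A' = A + n u` turns `x n + y (2A) + z k = 1` (with `A² − n k = m`,
`A'² − n k' = m`) into a certificate for `(n, 2A', k')`. -/
theorem bezout_congr {m n k k' A A' u : ℤ} (hA : A' = A + n * u) (hk : A ^ 2 - n * k = m) (hk' : A' ^ 2 - n * k' = m)
    (hn : n ≠ 0) (hp : ∃ x y z : ℤ, x * n + y * (2 * A) + z * k = 1) :
    ∃ x y z : ℤ, x * n + y * (2 * A') + z * k' = 1 := by
  obtain ⟨x, y, z, h⟩ := hp
  have hk'eq : k' = k + 2 * A * u + n * u ^ 2 := by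
    apply mul_left_cancel₀ hn
    rw [hA] at hk'
    linear_combination hk - hk'
  refine ⟨x - 2 * y * u + z * u ^ 2, y - z * u, z, ?_⟩
  rw [hk'eq, hA]
  linear_combination h

/-- **The bookkeeping gcd moves along the root**: `g ∣ A' − A` and `gcd(g, 2A) = 1` give `gcd(g, 2A') = 1`. -/
theorem gcd_congr {g A A' : ℤ} (hg : g ∣ A' - A) (h : Int.gcd g (2 * A) = 1) : Int.gcd g (2 * A') = 1 := by
  have hc : IsCoprime g (2 * A) := Int.isCoprime_iff_gcd_eq_one.2 h
  obtain ⟨t, ht⟩ := hg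
  have e : 2 * A' = 2 * A + g * (2 * t) := by linear_combination 2 * ht
  rw [e]
  exact Int.isCoprime_iff_gcd_eq_one.1 (hc.add_mul_left_right _)

/-- **THEOREM E «⇐», assembled** (LINE-LAW-THEOREMS-B §6″): an aligned compatible family at a common root `A` mod `L` is reached
at some `T = r·L`, at a root `A' ≡ A (mod L)` — every weight `c i` gets a primitive `z_i`, `N z_i = r·d i = T∕c i`, `z_i ∣ A' − √m`.
The auxiliary ideal comes from #B24 (Cox Cor. 7.17, kernel), the re-rooting from 315 ∕ 331, the capture from #B20. -/
theorem classLaw_reached {m : ℤ} (hm : m < 0) {ι : Type*} (s : Finset ι) {A L : ℤ} (c d : ι → ℤ)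
    (hL : 0 < L) (hd : ∀ i ∈ s, 0 < d i) (hcd : ∀ i ∈ s, c i * d i = L) (hdivL : L ∣ A * A - m)
    (hg1 : ∀ i ∈ s, Int.gcd (Int.gcd (d i) (c i) : ℤ) (2 * A) = 1)
    {i₀ : ι} (hi₀ : i₀ ∈ s) {k₀ : ℤ} (hk₀ : A ^ 2 - c i₀ * k₀ = m)
    (hp₀ : ∃ x y z : ℤ, x * c i₀ + y * (2 * A) + z * k₀ = 1)
    {kL : ℤ} (hkL : A ^ 2 - L * kL = m) (hpL : ∃ x y z : ℤ, x * L + y * (2 * A) + z * kL = 1)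
    (x y : ι → ℤ√m) (hy : ∀ i ∈ s, y i ≠ 0)
    (halign : ∀ i ∈ s, Ideal.span {x i} * Ideal.span {(c i : ℤ√m), ⟨-A, 1⟩} =
      Ideal.span {y i} * Ideal.span {(c i₀ : ℤ√m), ⟨-A, 1⟩}) :
    ∃ r A' : ℤ, 0 < r ∧ L ∣ A' - A ∧
      ∀ i ∈ s, ∃ z : ℤ√m, z.norm = r * d i ∧ z ∣ (⟨A', -1⟩ : ℤ√m) ∧ IsCoprime z.re z.im := by
  haveI : IsDomain (ℤ√m) := Zsqrtd.isDomain_of_neg hm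
  have hdL : ∀ i ∈ s, d i ∣ L := fun i hi => ⟨c i, by rw [mul_comm]; exact (hcd i hi).symm⟩
  have hcL : ∀ i ∈ s, c i ∣ L := fun i hi => ⟨d i, (hcd i hi).symm⟩
  have hc₀ : 0 < c i₀ := by
    rcases lt_or_ge 0 (c i₀) with h | h
    · exact h
    · have := mul_nonpos_of_nonpos_of_nonneg h (hd i₀ hi₀).le
      linarith [hcd i₀ hi₀]
  -- the two forms at `A`
  have hft : (⟨c i₀, 2 * A, k₀⟩ : BinQF).IsPosPrim (4 * m) := rootForm_isPosPrim hc₀ hk₀ hp₀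
  have hfL : (⟨L, 2 * A, kL⟩ : BinQF).IsPosPrim (4 * m) := rootForm_isPosPrim hL hkL hpL
  -- the auxiliary relation (#B24), `r` prime to `L`
  obtain ⟨r, B, k, hr, hcop, hk, -, x₀, y₀, hx₀, -, hrel⟩ := exists_aux_relation hm hfL hft hL.ne'
  rw [ideal_rootForm, ideal_rootForm] at hrel
  -- re-root: `A' ≡ A (mod L)`, `A' ≡ B (mod r)`
  obtain ⟨A', hA'A, hA'B, hdiv'⟩ :=
    root_glue hcop.symm (show L ∣ A ^ 2 - m by rw [sq]; exact hdivL) (show r ∣ B ^ 2 - m from ⟨k, by linear_combination hk⟩)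
  refine ⟨r, A', hr, hA'A, ?_⟩
  have hcong : ∀ n : ℤ, n ∣ L → Ideal.span ({(n : ℤ√m), ⟨-A, 1⟩} : Set (ℤ√m)) = Ideal.span {(n : ℤ√m), ⟨-A', 1⟩} :=
    fun n hn => span_pair_congr (dvd_sub_comm.1 (hn.trans hA'A))
  have hrB : Ideal.span ({(r : ℤ√m), ⟨-B, 1⟩} : Set (ℤ√m)) = Ideal.span {(r : ℤ√m), ⟨-A', 1⟩} :=
    span_pair_congr (dvd_sub_comm.1 hA'B)
  -- the data of #B20 at `A'`
  obtain ⟨k₀', hk₀'⟩ : c i₀ ∣ A' ^ 2 - m := ((hcL i₀ hi₀).trans (dvd_mul_right L r)).trans hdiv'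
  obtain ⟨u, hu⟩ := (hcL i₀ hi₀).trans hA'A
  have hA'eq : A' = A + c i₀ * u := by linear_combination hu
  have hk₀'' : A' ^ 2 - c i₀ * k₀' = m := by linear_combination hk₀'
  have hp₀' := bezout_congr hA'eq hk₀ hk₀'' hc₀.ne' hp₀
  have hg1' : ∀ i ∈ s, Int.gcd (Int.gcd (d i) (c i) : ℤ) (2 * A') = 1 := fun i hi =>
    gcd_congr (((Int.gcd_dvd_left _ _).trans (hdL i hi)).trans hA'A) (hg1 i hi)
  have hg2' : ∀ i ∈ s, Int.gcd (Int.gcd r (d i) : ℤ) (2 * A') = 1 := by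
    intro i hi
    have h1 : Int.gcd r (d i) = 1 := Int.isCoprime_iff_gcd_eq_one.1 (hcop.of_isCoprime_of_dvd_right (hdL i hi))
    rw [h1, Nat.cast_one, Int.gcd_one_left]
  have halign' : ∀ i ∈ s, Ideal.span {x i} * Ideal.span {(c i : ℤ√m), ⟨-A', 1⟩} =
      Ideal.span {y i} * Ideal.span {(c i₀ : ℤ√m), ⟨-A', 1⟩} := by
    intro i hi
    rw [← hcong (c i) (hcL i hi), ← hcong (c i₀) (hcL i₀ hi₀)]
    exact halign i hi
  have haux' : Ideal.span {x₀} * (Ideal.span {(r : ℤ√m), ⟨-A', 1⟩} * Ideal.span {(L : ℤ√m), ⟨-A', 1⟩}) =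
      Ideal.span {y₀} * Ideal.span {(c i₀ : ℤ√m), ⟨-A', 1⟩} := by
    rw [← hrB, ← hcong L dvd_rfl, ← hcong (c i₀) (hcL i₀ hi₀)]
    exact hrel
  have hdiv'' : r * L ∣ A' * A' - m := by rw [mul_comm r L, ← sq]; exact hdiv'
  exact classLaw_sufficiency hm s c d hr hd hcd hdiv'' hg1' hg2' hi₀ hk₀'' hp₀' x y hy halign' hx₀ haux'

/-- **Instance in numbers** (LINE-LAW-THEOREMS-B §6⁗'s cell `m = −39`, weights `{5, 8}`, `L = 40`; class group `ℤ∕4`, so not one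
class per genus): reached first at `T = 440 = 11·40` (`r = 11`), at the root `A = 169` (`169² + 39 = 28600 = 440·65`):
`N(7 + √−39) = 88 = 440∕5`, `N(4 − √−39) = 55 = 440∕8`, and both divide `169 − √−39`. -/
example : (169 : ℤ) ^ 2 + 39 = 440 * 65 ∧ (⟨7, 1⟩ : ℤ√(-39)).norm = 88 ∧ (⟨4, -1⟩ : ℤ√(-39)).norm = 55 ∧
    (⟨7, 1⟩ : ℤ√(-39)) * ⟨13, -2⟩ = ⟨169, -1⟩ ∧ (⟨4, -1⟩ : ℤ√(-39)) * ⟨13, 3⟩ = ⟨169, -1⟩ := by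
  refine ⟨by norm_num, by simp [Zsqrtd.norm], by simp [Zsqrtd.norm], by ext <;> simp, by ext <;> simp⟩

end Summit.Ventures.HSemireg.LineLawClassLawAssembled
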